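import Summits.MatrixMultiplication.OmegaCensus.STPP211TFirstReflectB
import Mathlib.Data.ZMod.Units

/-!
# ω-census, `(2,1,1)^k` T-first kernel engine — reflection E: colex order, the prefix lemma, canonical `c`-sets

HONEST FRAMING (pub-omega census; verbatim): lottery ticket; floor = certified bounds/negative ranges.
Census STRUCTURE bookkeeping of the STPP track (seat pub-omega-stpp-1, gen 38; STRUCTURE row B5, the threshold column
`T1(H) = max {k : (2,1,1)^k ⊆ H}`), not progress on `ω`: small patterns in small groups bound no exponent.

Fifth reflection file for `STPP211TFirstEngine.lean`: the T-phase's pruning is sound.  §10 COLEX: `CLT I P` («the least code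
where the masks differ is set in `I`»), its reading from the kernel test `canonBad` (`lowBit` of the `xor`), and a monotone
key (`revBits`: colex-smaller ⇒ larger reversed value) giving maximal = canonical elements.  §11 THE PREFIX LEMMA on finite
sets of codes: if an image of an initial segment `P` of `T` is colex-below `P`, the image of `T` is colex-below `T`.  §12 affine
images of a `c`-set in `ZMod n` (`aff u a S = {u (x − a)}`), their code sets, the kernel's `imageMask` as such an image, the
existence of a CANONICAL member of every affine orbit (no affine image colex-below it) and `0 ∈` it.

References: H. Cohn, R. Kleinberg, B. Szegedy, C. Umans, *Group-theoretic algorithms for matrix multiplication*, FOCS 2005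
(arXiv:math/0511460), Def. 5.1.  Desk record: pub-omega HOME `pub-omega-stpp-1-g38/`.
-/

namespace Summit.MatrixMultiplication.OmegaCensus

namespace STPP211T

open STPP211Neg
open Literature.Computability.Complexity (div_mod_block)
open Summit.MatrixMultiplication.OmegaCensus.T1Z2p5 (testBit_lowMask)
open Literature.Barriers.RiemannHypothesis.TuranCheck (beq_true_iff)

/-! ## 10. Colex on masks -/

/-- `I` is COLEX-BELOW `P`: the least position where the masks differ is set in `I`. -/
def CLT (I P : ℕ) : Prop := ∃ x0, I.testBit x0 = true ∧ P.testBit x0 = false ∧ ∀ z < x0, I.testBit z = P.testBit z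

/-- The lowest set bit is lowest: below the position of `lowBit G` every bit of `G` is clear. -/
theorem lowBit_min {G i : ℕ} (hG : G ≠ 0) (hL : lowBit G = 2 ^ i) : ∀ z < i, G.testBit z = false := by
  classical
  obtain ⟨i', hi', hbits⟩ := testBit_land_pred hG
  -- i' = i : both describe lowBit
  obtain ⟨i2, -, hL2, -, hbits2⟩ := lowBit_spec hG
  have hii2 : i2 = i := Nat.pow_right_injective (le_refl 2) (hL2.symm.trans hL)
  subst hii2
  -- the least set bit z0 of G
  have hex : ∃ z, G.testBit z = true := ⟨i', hi'⟩
  let z0 := Nat.find hex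
  have hz0 : G.testBit z0 = true := Nat.find_spec hex
  have hlow : ∀ j < z0, G.testBit j = false := fun j hj => by have := Nat.find_min hex hj; simpa using this
  -- decomposition G = 2^(z0+1) A + 2^z0, so (G &&& (G-1)) has bit z0 clear
  set A := G >>> (z0 + 1) with hA
  have hdec : G = 2 ^ (z0 + 1) * A + 2 ^ z0 := by
    apply Nat.eq_of_testBit_eq; intro j
    rw [Nat.testBit_two_pow_mul_add A (Nat.pow_lt_pow_right Nat.one_lt_two (Nat.lt_succ_self z0)) j]
    by_cases hj : j < z0 + 1
    · rw [if_pos hj, Nat.testBit_two_pow]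
      rcases Nat.lt_succ_iff_lt_or_eq.1 hj with hj' | rfl
      · rw [hlow j hj']; simp; omega
      · rw [hz0]; simp
    · rw [if_neg hj, hA, Nat.testBit_shiftRight]; congr 1; omega
  have hdec' : G - 1 = 2 ^ (z0 + 1) * A + (2 ^ z0 - 1) := by have h1 : 1 ≤ 2 ^ z0 := Nat.one_le_two_pow; omega
  have hclear : (G &&& (G - 1)).testBit z0 = false := by
    rw [Nat.testBit_land, hdec', Nat.testBit_two_pow_mul_add A (lt_of_lt_of_le (Nat.sub_lt Nat.one_le_two_pow Nat.one_pos)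
      (Nat.pow_le_pow_right Nat.two_pos (Nat.le_succ z0))), if_pos (Nat.lt_succ_self z0), Nat.testBit_two_pow_sub_one]
    simp
  -- hence z0 = i (the spec says the cleared bit is i)
  have hz0i : z0 = i2 := by
    by_contra hne
    have := hbits2 z0
    rw [land_eq] at this
    rw [this, hz0] at hclear
    simp [hne] at hclear
  intro z hz
  exact hlow z (by rw [hz0i]; exact hz)

/-- **Reading the kernel test**: `canonBad = true` exhibits a listed `a` and a listed unit `u` whose image is colex-below
the prefix mask. -/
theorem canonBad_true {c : TC} {L : List ℕ} {PM : ℕ} (h : canonBad c L PM = true) :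
    ∃ a ∈ L, ∃ u ∈ c.units, CLT (imageMask c L a u) PM := by
  obtain ⟨a, ha, h1⟩ := anyL_true h
  obtain ⟨u, hu, h2⟩ := anyL_true h1
  refine ⟨a, ha, u, hu, ?_⟩
  rw [force_eq, force_eq, Bool.and_eq_true] at h2
  obtain ⟨hd, hI⟩ := h2
  set I := imageMask c L a u
  have hd0 : Nat.xor I PM ≠ 0 := fun e => by rw [e] at hd; exact Bool.noConfusion hd
  obtain ⟨i, hi, hL⟩ := lowBit_eq_two_pow hd0
  rw [hL] at hI
  have hIi : I.testBit i = true := by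
    by_contra hf
    rw [Bool.not_eq_true] at hf
    apply absurd _ (Bool.noConfusion : ¬ (!Nat.beq (0 : ℕ) 0) = true)
    have : Nat.land I (2 ^ i) = 0 := by
      apply Nat.eq_of_testBit_eq; intro j
      rw [land_eq, Nat.testBit_land, Nat.zero_testBit, Nat.testBit_two_pow]
      by_cases hij : i = j
      · subst hij; rw [hf]; rfl
      · simp [hij]
    rwa [this] at hI
  refine ⟨i, hIi, ?_, fun z hz => ?_⟩
  · rw [xor_eq, Nat.testBit_xor, hIi] at hi
    revert hi; cases PM.testBit i <;> simp
  · have := lowBit_min hd0 hL z hz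
    rw [xor_eq, Nat.testBit_xor] at this
    revert this; cases I.testBit z <;> cases PM.testBit z <;> simp

/-- Reversal of the low `m` bits of `A` (colex-smaller masks have LARGER reversals). -/
def revBits (A : ℕ) : ℕ → ℕ
  | 0 => 0
  | m + 1 => 2 * revBits A m + (if A.testBit m then 1 else 0)

/-- Bits of `revBits`. -/
theorem testBit_revBits (A : ℕ) : ∀ m i, (revBits A m).testBit i = (decide (i < m) && A.testBit (m - 1 - i)) := by
  intro m
  induction m with
  | zero => intro i; simp [revBits]
  | succ m ih =>
      intro i
      have hb : (if A.testBit m then 1 else 0) < 2 ^ 1 := by split <;> simp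
      rw [revBits, show 2 * revBits A m = 2 ^ 1 * revBits A m by ring, Nat.testBit_two_pow_mul_add _ hb]
      by_cases hi : i < 1
      · rw [if_pos hi]
        have hi0 : i = 0 := by omega
        subst hi0
        cases hA : A.testBit m <;> simp [hA]
      · rw [if_neg hi, ih]
        by_cases him : i - 1 < m
        · have h1 : i < m + 1 := by omega
          have h2 : m - 1 - (i - 1) = m + 1 - 1 - i := by omega
          simp [him, h1, h2]
        · have h1 : ¬ (i < m + 1) := by omega
          simp [him, h1]

/-- **Colex-below ⇒ larger reversal** (for a mask `I` living below `2^m`). -/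
theorem rev_lt_of_CLT {I P m : ℕ} (hI : I < 2 ^ m) (h : CLT I P) : revBits P m < revBits I m := by
  obtain ⟨x0, hIx, hPx, hlow⟩ := h
  have hx0 : x0 < m := by
    by_contra hc
    rw [not_lt] at hc
    rw [Nat.testBit_lt_two_pow (lt_of_lt_of_le hI (Nat.pow_le_pow_right Nat.two_pos hc))] at hIx
    exact Bool.noConfusion hIx
  apply Nat.lt_of_testBit (m - 1 - x0)
  · rw [testBit_revBits, show m - 1 - (m - 1 - x0) = x0 by omega, hPx]; simp
  · rw [testBit_revBits, show m - 1 - (m - 1 - x0) = x0 by omega, hIx]; simp; omega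
  · intro j hj
    rw [testBit_revBits, testBit_revBits]
    by_cases hjm : j < m
    · have : m - 1 - j < x0 := by omega
      rw [hlow _ this]
    · simp [hjm]

/-! ## 11. The prefix lemma -/

/-- Colex-below for finite sets of codes. -/
def CLTset (X Y : Finset ℕ) : Prop := ∃ x0 ∈ X, x0 ∉ Y ∧ ∀ z < x0, (z ∈ X ↔ z ∈ Y)

/-- Colex-below on masks is colex-below on their bit sets. -/
theorem CLTset_of_CLT {I P : ℕ} {X Y : Finset ℕ} (hX : ∀ z, I.testBit z = true ↔ z ∈ X)
    (hY : ∀ z, P.testBit z = true ↔ z ∈ Y) (h : CLT I P) : CLTset X Y := by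
  obtain ⟨x0, hI, hP, hlow⟩ := h
  refine ⟨x0, (hX x0).1 hI, fun hy => by rw [(hY x0).2 hy] at hP; exact Bool.noConfusion hP, fun z hz => ?_⟩
  rw [← hX z, ← hY z, hlow z hz]

/-- **THE PREFIX LEMMA.** `P` an initial segment of `T`, `I ⊆ X` with `|I| ≤ |P|` (an image of `P` inside the image of `T`):
if `I` is colex-below `P` then `X` is colex-below `T`. -/
theorem clt_lift {P T I X : Finset ℕ} (hseg : ∀ y ∈ T, y ∉ P → ∀ x ∈ P, x < y) (hIX : I ⊆ X)
    (hcard : I.card ≤ P.card) (h : CLTset I P) : CLTset X T := by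
  classical
  obtain ⟨x0, hx0I, hx0P, hlow⟩ := h
  -- x0 lies below some element of P (else P ⊊ I, too many elements)
  have hbelow : ∃ x ∈ P, x0 < x := by
    by_contra hc
    simp only [not_exists, not_and, not_lt] at hc
    have hsub : P ⊆ I := fun z hz => (hlow z (lt_of_le_of_ne (hc z hz) (fun e => hx0P (e ▸ hz)))).2 hz
    have : (insert x0 P).card ≤ I.card := Finset.card_le_card (Finset.insert_subset hx0I hsub)
    rw [Finset.card_insert_of_notMem hx0P] at this
    omega
  have hx0T : x0 ∉ T := fun hT => by
    obtain ⟨x, hxP, hlt⟩ := hbelow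
    exact absurd (hseg x0 hT hx0P x hxP) (not_lt.2 (le_of_lt hlt))
  -- the least element of the symmetric difference of X and T
  set D := (X \ T) ∪ (T \ X) with hD
  have hx0D : x0 ∈ D := by rw [hD, Finset.mem_union, Finset.mem_sdiff]; exact Or.inl ⟨hIX hx0I, hx0T⟩
  have hDne : D.Nonempty := ⟨x0, hx0D⟩
  set x1 := D.min' hDne with hx1
  have hx1D : x1 ∈ D := Finset.min'_mem D hDne
  have hx1le : x1 ≤ x0 := Finset.min'_le D x0 hx0D
  have hmin : ∀ z ∈ D, x1 ≤ z := fun z hz => Finset.min'_le D z hz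
  refine ⟨x1, ?_, ?_, fun z hz => ?_⟩
  · -- x1 ∈ X: otherwise x1 ∈ T \ X, x1 < x0, so x1 ∈ P ⊆ I ⊆ X
    rw [hD, Finset.mem_union, Finset.mem_sdiff, Finset.mem_sdiff] at hx1D
    rcases hx1D with ⟨h1, _⟩ | ⟨hT, hX⟩
    · exact h1
    · exfalso
      have hne : x1 ≠ x0 := fun e => hx0T (e ▸ hT)
      have hlt : x1 < x0 := lt_of_le_of_ne hx1le hne
      obtain ⟨x, hxP, hx0x⟩ := hbelow
      have hx1P : x1 ∈ P := by
        by_contra hnP; exact absurd (hseg x1 hT hnP x hxP) (not_lt.2 (le_of_lt (lt_trans hlt hx0x)))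
      exact hX (hIX ((hlow x1 hlt).2 hx1P))
  · intro hT
    rw [hD, Finset.mem_union, Finset.mem_sdiff, Finset.mem_sdiff] at hx1D
    rcases hx1D with ⟨_, h2⟩ | ⟨_, hX⟩
    · exact h2 hT
    · -- as above, x1 ∈ T \ X is impossible
      have hne : x1 ≠ x0 := fun e => hx0T (e ▸ hT)
      have hlt : x1 < x0 := lt_of_le_of_ne hx1le hne
      obtain ⟨x, hxP, hx0x⟩ := hbelow
      have hx1P : x1 ∈ P := by
        by_contra hnP; exact absurd (hseg x1 hT hnP x hxP) (not_lt.2 (le_of_lt (lt_trans hlt hx0x)))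
      exact hX (hIX ((hlow x1 hlt).2 hx1P))
  · -- below x1 the sets X and T agree (minimality of x1 in the symmetric difference)
    by_contra hne
    have hzD : z ∈ D := by
      rw [hD, Finset.mem_union, Finset.mem_sdiff, Finset.mem_sdiff]
      by_cases hzX : z ∈ X
      · exact Or.inl ⟨hzX, fun hzT => hne ⟨fun _ => hzT, fun _ => hzX⟩⟩
      · exact Or.inr ⟨by by_contra hzT; exact hne ⟨fun h => absurd h hzX, fun h => absurd h hzT⟩, hzX⟩
    exact absurd (hmin z hzD) (not_le.2 hz)

/-! ## 12. Affine images and canonical `c`-sets -/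

section Affine

variable {n : ℕ} [NeZero n]

/-- The affine image `{u (x − a) : x ∈ S}`. -/
noncomputable def aff (u a : ZMod n) (S : Finset (ZMod n)) : Finset (ZMod n) := S.image fun x => u * (x - a)

/-- The code set of a set of residues. -/
noncomputable def codes (S : Finset (ZMod n)) : Finset ℕ := S.image ZMod.val

/-- The mask of a finite set of codes (through its sorted list). -/
noncomputable def maskS (X : Finset ℕ) : ℕ := maskL (X.sort (· ≤ ·))

omit [NeZero n] in
/-- Bits of `maskS`. -/
theorem testBit_maskS (X : Finset ℕ) (z : ℕ) : (maskS X).testBit z = true ↔ z ∈ X := by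
  unfold maskS; rw [testBit_maskL]; simp

omit [NeZero n] in
/-- Composition of affine maps: `aff u a ∘ aff w b = aff (u w) (b + w⁻¹ a)` for a unit `w`. -/
theorem aff_aff (u a b : ZMod n) (w : (ZMod n)ˣ) (S : Finset (ZMod n)) :
    aff u a (aff (w : ZMod n) b S) = aff (u * (w : ZMod n)) (b + ((w⁻¹ : (ZMod n)ˣ) : ZMod n) * a) S := by
  classical
  unfold aff
  rw [Finset.image_image]
  congr 1
  funext x
  simp only [Function.comp]
  have hw : (w : ZMod n) * ((w⁻¹ : (ZMod n)ˣ) : ZMod n) = 1 := Units.mul_inv w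
  linear_combination (u * a) * hw

omit [NeZero n] in
/-- Colex-below on code sets gives colex-below on their masks. -/
theorem CLT_of_CLTset {X Y : Finset ℕ} (h : CLTset X Y) : CLT (maskS X) (maskS Y) := by
  obtain ⟨x0, hx0, hnot, hlow⟩ := h
  refine ⟨x0, (testBit_maskS _ _).2 hx0, ?_, fun z hz => ?_⟩
  · cases hb : (maskS Y).testBit x0
    · rfl
    · exact absurd ((testBit_maskS _ _).1 hb) hnot
  · have := hlow z hz
    cases h1 : (maskS X).testBit z <;> cases h2 : (maskS Y).testBit z
    · rfl
    · have := this.2 ((testBit_maskS _ _).1 h2); rw [← testBit_maskS, h1] at this; exact Bool.noConfusion this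
    · have := this.1 ((testBit_maskS _ _).1 h1); rw [← testBit_maskS, h2] at this; exact Bool.noConfusion this
    · rfl

/-- The mask of a code set of residues lives below `2^n`. -/
theorem maskS_codes_lt (S : Finset (ZMod n)) : maskS (codes S) < 2 ^ n := by
  classical
  unfold maskS
  apply maskL_lt
  intro t ht
  rw [Finset.mem_sort] at ht
  unfold codes at ht
  rw [Finset.mem_image] at ht
  obtain ⟨x, -, rfl⟩ := ht
  exact ZMod.val_lt x

/-- **A CANONICAL MEMBER OF THE ORBIT.** For every finite `S₀ ⊆ ZMod n` there are a unit `w` and a shift `b` such that no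
affine image (by a unit) of `S = aff w b S₀` has its code set colex-below the code set of `S`. -/
theorem exists_canon (S0 : Finset (ZMod n)) :
    ∃ (w : (ZMod n)ˣ) (b : ZMod n), ∀ (u : (ZMod n)ˣ) (a : ZMod n),
      ¬ CLTset (codes (aff (u : ZMod n) a (aff (w : ZMod n) b S0))) (codes (aff (w : ZMod n) b S0)) := by
  classical
  let F : Finset ((ZMod n)ˣ × ZMod n) := Finset.univ
  have hF : F.Nonempty := ⟨(1, 0), Finset.mem_univ _⟩
  obtain ⟨⟨w, b⟩, -, hmax⟩ :=
    Finset.exists_max_image F (fun wb => revBits (maskS (codes (aff (wb.1 : ZMod n) wb.2 S0))) n) hF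
  refine ⟨w, b, fun u a hclt => ?_⟩
  rw [aff_aff] at hclt
  have hle := hmax (u * w, b + ((w⁻¹ : (ZMod n)ˣ) : ZMod n) * a) (Finset.mem_univ _)
  simp only [Units.val_mul] at hle
  exact absurd hle (not_le.2 (rev_lt_of_CLT (maskS_codes_lt _) (CLT_of_CLTset hclt)))

omit [NeZero n] in
/-- A canonical member contains `0`. -/
theorem zero_mem_canon {S : Finset (ZMod n)} (hS : S.Nonempty)
    (hcan : ∀ (u : (ZMod n)ˣ) (a : ZMod n), ¬ CLTset (codes (aff (u : ZMod n) a S)) (codes S)) : (0 : ZMod n) ∈ S := by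
  classical
  by_contra h0
  obtain ⟨x, hx⟩ := hS
  apply hcan 1 x
  refine ⟨0, ?_, ?_, fun z hz => absurd hz (Nat.not_lt_zero z)⟩
  · unfold codes aff
    rw [Finset.mem_image]
    exact ⟨0, Finset.mem_image.2 ⟨x, hx, by simp⟩, ZMod.val_zero⟩
  · unfold codes
    rw [Finset.mem_image]
    rintro ⟨y, hy, hy0⟩
    exact h0 ((ZMod.val_eq_zero y).1 hy0 ▸ hy)

end Affine

end STPP211T

end Summit.MatrixMultiplication.OmegaCensus
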